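import Summits.HodgeConjecture.HodgeConjecture.Theorems.F0P3cStCharTSAdjugateEigen        -- ★ (E2) kit: pairing algebra + adjugate eigenvector engine (this seat)
import Summits.HodgeConjecture.HodgeConjecture.Theorems.F0P3cStCharTSEllipticCriterion    -- ★ p849661 (E1): `exists_isRoot_of_exists_conj_mem_torusU`, `coe_conj` (this seat)
import Summits.HodgeConjecture.HodgeConjecture.Theorems.F0P3cStCharTSWeylHypNormaliser    -- ★ p849560 (A2): `antidiagonal_over_apply` (LH2-p01 (g3))
import Mathlib.LinearAlgebra.CrossProduct
import HarnessLib

/-!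
# F0 · P3c · line LH6 «StCharTS» — «ELL-CRIT★» (E2): THE CONVERSE EIGENVALUE TEST — a regular `γ ∈ U(σ, Φ₃)(K)` with an eigenvalue `α`, `α σ(α) ≠ 1`,
# is `U`-conjugate into the split torus `M`, to `diag(α, β, σ(α)⁻¹)` [Rogawski1990 §12.5 p. 182; §3.6; §1.10 p. 9]

Cell `pub/hodgecm-mathlib`, crux H413 = `stmt-HodgeConjecture-24833` (`--supports` lane, helper), route HCCMUnconditional; seat F0P2-p02 (g15),
deal «ELL-CRIT★» of F0P3b-plan (g23) 2026-09-02T05:43:16Z, part (E2) (census asked for Witt ∕ isotropic eigenline ∕ Borel–Levi; consumer F0P3a-p05 (g19)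
(H3) `Theorems/F0P3cStCharTSHyperbolicCore`).  THEOREMS ONLY, sorry-free, no definition ∕ instance ∕ notation ∕ named fact.

THE STATEMENT.  `K` a field, `σ : K →+* K` an involution (`σ ∘ σ = id`; `σ = id` allowed), `J = Φ₃ = (StdForm.antidiagonal 3).over K`, `U = ↥(unitaryGroupOfForm σ J)`,
`M = torusU σ J` the diagonal torus.  For `γ ∈ U` REGULAR (separable characteristic polynomial) with a root `α ∈ K` of `charpoly ↑γ` such that `α σ(α) ≠ 1`:
`∃ g ∈ U, g γ g⁻¹ ∈ M`, and the diagonal is `(α, β, σ(α)⁻¹)` (`exists_conj_mem_torusU_of_isRoot`); with ★ (E1) this is the IFF `exists_conj_mem_torusU_iff`;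
`exists_conj_mem_torusU_of_isRoot_of_isUnit` is the same over a FIELD-LIKE commutative ring (`x ≠ 0 → IsUnit x`, the WEYL-HYP convention for the local carrier
`UnitaryGroup.LocalRing L v` at a non-split `v`), by `IsField.toField` on the nose.
THE ROAD (as proved — an explicit HYPERBOLIC–ORTHOGONAL EIGENFRAME; no Witt theorem, no Borel–Levi decomposition, no dimension count, no Hensel):
(1) `Q := adj(α·1 − ↑γ)`; Jacobi (★ kit) `tr Q = charpoly′(α) ≠ 0` by separability, so some `Q i i ≠ 0`; the column `v := Q eᵢ` is a right `α`-eigenvector, the row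
`r := eᵢᵀ Q` a left one, and by RANK ONE of the adjugate (★ kit) they PAIR: `r · v = Q i i · tr Q ≠ 0`.  (2) The partner `v′ := σ ∘ (Φ₃ r)` is a right eigenvector for
`α* := σ(α)⁻¹` with `h(v′, y) = r · y` (`h = hermForm σ Φ₃`), from the transposed unitarity `ᵗγ Φ₃ σ(γ) = Φ₃`.  (3) `v`, `v′` are ISOTROPIC (★ kit eigen-orthogonality,
`σ(α)α ≠ 1`, `σ(α*)α* = (σ(α)α)⁻¹ ≠ 1`), and `a := h(v, v′) = σ(h(v′, v)) = σ(r · v) ≠ 0`.  (4) `w := c₁ ⨯₃ r` (Mathlib cross product of the two row functionals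
`c₁ = (σ∘v)Φ₃`, `r`) is `h`-orthogonal to `v` and `v′`; `det [v | w | v′] = h(v, v′) h(v′, v) ≠ 0` (`cross_dot_cross`).  (5) The Gram determinant gives
`h(w, w) = h(v, v′) h(v′, v)`; `γ w = β w` by coordinates in the frame; the normalised frame `B = [v | a⁻¹ w | a⁻¹ v′]` has Gram matrix `Φ₃` (so `B ∈ U`) and
`B⁻¹ γ B = diag(α, β, α*)` (`exists_unitary_frame_diagonal_of_isRoot`, matrix form).
NOT HERE (honest census): the `IsRegularElt`-FREE form (regularity is in fact an OUTPUT: the Borel form of such a `γ` has pairwise distinct diagonal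
`(α, β, σ(α)⁻¹)`, `β σ(β) = 1` — F0P3a-p05 (g19) 05:59:11Z (c)); here separability is load-bearing at step (1) (simplicity of `α`).  It is the next edition.
HONEST LABEL: HC_CM is proved only modulo the 7 printed citations (2 remaining: hLiu418 = `stmt-HodgeConjecture-24832`, h413 = `stmt-HodgeConjecture-24833`)
until rung 0 closes; this file is count-neutral package-side algebra and closes no organ.

## References
* [Rogawski1990] J. D. Rogawski, *Automorphic Representations of Unitary Groups in Three Variables*, Ann. of Math. Stud. 123 (1990), §12.5 p. 182 (regular
  hyperbolic set, split torus), §3.6 (elliptic elements), §1.9–§1.10 pp. 8–9 (`Φ`, `B = MN`, `M = {d(α, β, ᾱ⁻¹)}`), §3.1 p. 19 (regular elements).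
* [HornJohnson2013] R. A. Horn, C. R. Johnson, *Matrix Analysis*, 2nd ed. (2013), §0.8.2, (0.8.10.1), §1.4 (adjugate, Jacobi's formula, left∕right eigenvectors).
-/

set_option autoImplicit false
set_option linter.dupNamespace false

open Matrix Polynomial
open Literature.NumberTheory.Automorphic Literature.NumberTheory.Automorphic.UnitaryGroup Literature.NumberTheory.Rogawski1990
open Summit.HodgeConjecture.HodgeConjecture.Cruxes.H413.F0P3cStCharTSAdjugateEigen
open Summit.HodgeConjecture.HodgeConjecture.Cruxes.H413.F0P3cStCharTSEllipticCriterion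
open Summit.HodgeConjecture.HodgeConjecture.Cruxes.H413.F0P3cStCharTSWeylHypNormaliser
open scoped MatrixGroups

namespace Summit.HodgeConjecture.HodgeConjecture.Cruxes.H413.F0P3cStCharTSEllipticCriterionConverse

/-! ## §1 The matrix core over a field: an explicit unitary frame diagonalising `γ` -/

section Core

variable {K : Type*} [Field K] (σ : K →+* K)

/-- The explicit antidiagonal form `Φ₃ = antidiag(1, 1, 1)`: symmetric, an involution, `σ`-fixed, `det = −1`. [cite: Rogawski1990, §1.9 p. 8] -/
private theorem phi3_facts {J : Matrix (Fin 3) (Fin 3) K} (hJ : ∀ i j, J i j = if j = i.rev then 1 else 0) :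
    J = !![0, 0, 1; 0, 1, 0; 1, 0, 0] ∧ Jᵀ = J ∧ J * J = 1 ∧ J.map σ = J ∧ J.det = -1 := by
  have hJ' : J = !![0, 0, 1; 0, 1, 0; 1, 0, 0] := by
    ext i j; rw [hJ]; fin_cases i <;> fin_cases j <;> rfl
  subst hJ'
  refine ⟨rfl, ?_, ?_, ?_, ?_⟩
  · ext i j; fin_cases i <;> fin_cases j <;> rfl
  · ext i j; fin_cases i <;> fin_cases j <;> simp [Matrix.mul_apply, Fin.sum_univ_three]
  · ext i j; fin_cases i <;> fin_cases j <;> simp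
  · simp [det_fin_three]

/-- **«ELL-CRIT★» (E2), MATRIX FORM.**  `K` a field, `σ` an involutive ring endomorphism, `J = Φ₃` (given by its entries), `M` a matrix with `(σM)ᵀ J M = J`,
`det M ≠ 0`, SEPARABLE characteristic polynomial, and a root `α` with `α σ(α) ≠ 1`.  Then there is an invertible `B` with `(σB)ᵀ J B = J` (a unitary frame) and
`B⁻¹ M B = diag(d)`, `d 0 = α`, `d 2 = σ(α)⁻¹`, all `d k ≠ 0`.  Proof = the road of the module docstring (adjugate eigenvectors `v = Q eᵢ`, `r = eᵢᵀ Q`, partner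
`v′ = σ ∘ (J r)`, middle vector `w = c₁ ⨯₃ r`, Gram determinant, normalisation `[v | a⁻¹ w | a⁻¹ v′]`).
[cite: Rogawski1990, §12.5 p. 182] [cite: HornJohnson2013, §0.8.2] -/
theorem exists_unitary_frame_diagonal_of_isRoot {J M : Matrix (Fin 3) (Fin 3) K} (hσ : ∀ a, σ (σ a) = a) (hJ : ∀ i j, J i j = if j = i.rev then 1 else 0)
    (hM : (M.map σ)ᵀ * J * M = J) (hdet : M.det ≠ 0) (hsep : M.charpoly.Separable) {α : K} (hα : M.charpoly.IsRoot α)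
    (hne : α * σ α ≠ 1) :
    ∃ B : Matrix (Fin 3) (Fin 3) K, B.det ≠ 0 ∧ (B.map σ)ᵀ * J * B = J ∧
      ∃ d : Fin 3 → K, (∀ k, d k ≠ 0) ∧ d 0 = α ∧ d 2 = (σ α)⁻¹ ∧ B⁻¹ * M * B = diagonal d := by
  obtain ⟨hJe, hJt, hJJ, hJσ, hJdet⟩ := phi3_facts σ hJ
  have hσinj : Function.Injective σ := σ.injective
  -- one-sided sesquilinearity (the joint form is ★ kit `hermForm_smul_smul_eq`)
  have hsl : ∀ (c : K) (x y : Fin 3 → K), hermForm σ J (c • x) y = σ c * hermForm σ J x y := fun c x y => by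
    simpa using hermForm_smul_smul_eq σ J c 1 x y
  have hsr : ∀ (c : K) (x y : Fin 3 → K), hermForm σ J x (c • y) = c * hermForm σ J x y := fun c x y => by
    simpa using hermForm_smul_smul_eq σ J 1 c x y
  -- the singular matrix `α·1 − M` and its adjugate
  set A₀ : Matrix (Fin 3) (Fin 3) K := scalar (Fin 3) α - M with hA₀def
  have hA₀ : A₀.det = 0 := by rw [hA₀def, ← eval_charpoly]; exact hα
  set Q : Matrix (Fin 3) (Fin 3) K := adjugate A₀ with hQdef
  -- Jacobi: `tr Q = p′(α) ≠ 0`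
  have htr : trace Q ≠ 0 := by
    rw [hQdef, hA₀def, trace_adjugate_scalar_sub_eq_eval_derivative_charpoly]
    exact hsep.eval₂_derivative_ne_zero (RingHom.id K) hα
  obtain ⟨i, -, hii⟩ : ∃ i ∈ Finset.univ, Q i i ≠ 0 := Finset.exists_ne_zero_of_sum_ne_zero htr
  -- the right eigenvector `v` (column `i`) and the left eigenvector `r` (row `i`) of `Q`, both for `α`
  set v : Fin 3 → K := fun k => Q k i with hvdef
  set r : Fin 3 → K := fun k => Q i k with hrdef
  have hv : M *ᵥ v = α • v := mulVec_adjugate_col_eq_smul M α hA₀ i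
  have hr : r ᵥ* M = α • r := vecMul_adjugate_row_eq_smul M α hA₀ i
  have hpair : r ⬝ᵥ v = Q i i * trace Q := by
    rw [← adjugate_mul_adjugate_apply_self_of_det_eq_zero A₀ hA₀ i, mul_apply]; rfl
  have hpair_ne : r ⬝ᵥ v ≠ 0 := by rw [hpair]; exact mul_ne_zero hii htr
  have hv_ne : v ≠ 0 := fun h => hii (by simpa [hvdef] using congrFun h i)
  have hα0 : α ≠ 0 := by
    rintro rfl
    rw [zero_smul] at hv
    exact hv_ne ((Matrix.mulVec_injective_iff_isUnit.2 ((Matrix.isUnit_iff_isUnit_det M).2 (isUnit_iff_ne_zero.2 hdet)))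
      (by rw [hv, mulVec_zero]))
  have hσα0 : σ α ≠ 0 := (map_ne_zero σ).2 hα0
  -- the partner eigenvector `v' := σ ∘ (J r)` for `α* = (σ α)⁻¹`, with `h(v', y) = r · y`
  set v' : Fin 3 → K := ⇑σ ∘ (J *ᵥ r) with hv'def
  have hσv' : (⇑σ ∘ v') = J *ᵥ r := funext fun k => hσ _
  have hF1 : ∀ y, hermForm σ J v' y = r ⬝ᵥ y := fun y => by
    rw [hermForm_apply, hσv', ← vecMul_transpose, ← dotProduct_mulVec, mulVec_mulVec, hJt, hJJ, one_mulVec]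
  have hF2 : M *ᵥ v' = (σ α)⁻¹ • v' := by
    -- transpose of the unitarity relation, applied to `u := J r`
    have hMt : Mᵀ * J * M.map σ = J := by
      have e := congrArg transpose hM
      rwa [transpose_mul, transpose_mul, transpose_transpose, hJt, ← mul_assoc] at e
    have hr' : Mᵀ *ᵥ r = α • r := by rw [mulVec_transpose]; exact hr
    set z : Fin 3 → K := M.map σ *ᵥ (J *ᵥ r) with hzdef
    have h1 : Mᵀ *ᵥ (J *ᵥ z) = Mᵀ *ᵥ (α⁻¹ • r) := by
      rw [hzdef, mulVec_mulVec, mulVec_mulVec, hMt, mulVec_smul, hr', smul_smul, inv_mul_cancel₀ hα0, one_smul,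
        mulVec_mulVec, hJJ, one_mulVec]
    have hinjT : Function.Injective (Mᵀ).mulVec :=
      Matrix.mulVec_injective_iff_isUnit.2 ((Matrix.isUnit_iff_isUnit_det _).2 (by rw [det_transpose]; exact isUnit_iff_ne_zero.2 hdet))
    have h2 : J *ᵥ z = α⁻¹ • r := hinjT h1
    have h3 : z = α⁻¹ • (J *ᵥ r) := by
      have e := congrArg (J.mulVec) h2
      rwa [mulVec_mulVec, hJJ, one_mulVec, mulVec_smul] at e
    -- `σ ∘ (M v') = z`
    have h4 : (⇑σ ∘ (M *ᵥ v')) = z := by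
      rw [hzdef, ← hσv']; exact funext fun k => RingHom.map_mulVec σ M v' k
    funext k
    have e := congrFun h4 k
    simp only [Function.comp_apply, h3, Pi.smul_apply, smul_eq_mul] at e
    have e2 := congrArg σ e
    rw [hσ, map_mul, map_inv₀] at e2
    rw [e2, Pi.smul_apply, smul_eq_mul, hv'def, Function.comp_apply]
  set αs : K := (σ α)⁻¹ with hαsdef
  have hαs0 : αs ≠ 0 := inv_ne_zero hσα0
  have hσαs0 : σ αs ≠ 0 := (map_ne_zero σ).2 hαs0
  have hσαs : σ αs * αs = (σ α * α)⁻¹ := by rw [hαsdef, map_inv₀, hσ, mul_inv, mul_comm]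
  have hne' : σ α * α ≠ 1 := by rwa [mul_comm]
  -- isotropy of `v` and `v'`
  have hiso_v : hermForm σ J v v = 0 := by
    have e := sub_one_mul_hermForm_eq_zero_of_eigen σ hM hv hv
    exact (mul_eq_zero.1 e).resolve_left (sub_ne_zero.2 hne')
  have hiso_v' : hermForm σ J v' v' = 0 := by
    have e := sub_one_mul_hermForm_eq_zero_of_eigen σ hM hF2 hF2
    refine (mul_eq_zero.1 e).resolve_left (sub_ne_zero.2 ?_)
    rw [hσαs]; exact fun h => hne' (inv_eq_one.1 h)
  -- the pairing `ā := h(v', v) = r · v ≠ 0`, `a := h(v, v') = σ ā ≠ 0`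
  set ab : K := hermForm σ J v' v with habdef
  have hab : ab = r ⬝ᵥ v := hF1 v
  have hab0 : ab ≠ 0 := by rw [hab]; exact hpair_ne
  set a : K := hermForm σ J v v' with hadef
  have ha : a = σ ab := by rw [hadef, habdef]; exact hermForm_comm σ hσ hJt hJσ v' v
  have ha0 : a ≠ 0 := by rw [ha]; exact (map_ne_zero σ).2 hab0
  have hσa : σ a = ab := by rw [ha, hσ]
  -- the middle vector `w := c₁ × r`, `c₁` the row functional of `v`
  set c₁ : Fin 3 → K := (⇑σ ∘ v) ᵥ* J with hc₁def
  have hc₁ : ∀ y, hermForm σ J v y = c₁ ⬝ᵥ y := fun y => hermForm_eq_vecMul_dotProduct σ J v y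
  set w : Fin 3 → K := c₁ ⨯₃ r with hwdef
  have hvw : hermForm σ J v w = 0 := by rw [hc₁, hwdef]; exact dot_self_cross c₁ r
  have hv'w : hermForm σ J v' w = 0 := by rw [hF1, hwdef]; exact dot_cross_self c₁ r
  have hwv : hermForm σ J w v = 0 := by rw [hermForm_comm σ hσ hJt hJσ v w, hvw, map_zero]
  have hwv' : hermForm σ J w v' = 0 := by rw [hermForm_comm σ hσ hJt hJσ v' w, hv'w, map_zero]
  -- the frame `A = [v | w | v']` and its determinant `a ā`
  set A : Matrix (Fin 3) (Fin 3) K := (Matrix.of ![v, w, v'])ᵀ with hAdef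
  have hA0 : ∀ k, A k 0 = v k := fun k => by simp [hAdef]
  have hA1 : ∀ k, A k 1 = w k := fun k => by simp [hAdef]
  have hA2 : ∀ k, A k 2 = v' k := fun k => by simp [hAdef]
  have hdetA : A.det = a * ab := by
    rw [hAdef, det_transpose]
    change Matrix.det ![v, w, v'] = a * ab
    rw [← triple_product_eq_det, triple_product_permutation, hwdef, cross_dot_cross, ← hc₁, ← hc₁, ← hF1, ← hF1,
      hiso_v, hiso_v']
    ring
  have hdetA0 : A.det ≠ 0 := by rw [hdetA]; exact mul_ne_zero ha0 hab0
  -- the Gram determinant: `c := h(w, w) = a ā`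
  set c : K := hermForm σ J w w with hcdef
  have hGram : ((A.map σ)ᵀ * J * A).det = σ (A.det) * J.det * A.det := by
    rw [det_mul, det_mul, det_transpose, ← RingHom.mapMatrix_apply, ← RingHom.map_det]
  have hGram' : ((A.map σ)ᵀ * J * A).det = -(a * c * ab) := by
    have hG : (A.map σ)ᵀ * J * A = !![0, 0, a; 0, c, 0; ab, 0, 0] := by
      ext i' j'
      rw [transpose_map_mul_mul_apply]
      fin_cases i' <;> fin_cases j' <;> simp [hA0, hA1, hA2] <;>
        first
        | exact hiso_v
        | exact hvw
        | exact hadef.symm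
        | exact hwv
        | exact hcdef.symm
        | exact hwv'
        | exact habdef.symm
        | exact hv'w
        | exact hiso_v'
    rw [hG, det_fin_three]; simp
  have hc : c = a * ab := by
    have e := hGram.symm.trans hGram'
    rw [hdetA, hJdet, map_mul, hσa, ← ha] at e
    -- `ab * a * (-1) * (a * ab) = -(a * c * ab)`
    have e2 : a * ab * (c - a * ab) = 0 := by linear_combination e
    rcases mul_eq_zero.1 e2 with h | h
    · exact absurd h (mul_ne_zero ha0 hab0)
    · exact sub_eq_zero.1 h
  have hc0 : c ≠ 0 := by rw [hc]; exact mul_ne_zero ha0 hab0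
  -- `M w = β w`: `M w` is `h`-orthogonal to `v` and `v'`, and `{v, w, v'}` is a basis
  have hvMw : c₁ ⬝ᵥ (M *ᵥ w) = 0 := by
    have e := hermForm_mulVec σ hM v w
    rw [hv, hsl, hvw] at e
    rw [← hc₁]; exact (mul_eq_zero.1 e).resolve_left hσα0
  have hv'Mw : r ⬝ᵥ (M *ᵥ w) = 0 := by
    have e := hermForm_mulVec σ hM v' w
    rw [hF2, hsl, hv'w] at e
    rw [← hF1]; exact (mul_eq_zero.1 e).resolve_left hσαs0
  obtain ⟨y, hy⟩ : ∃ y, A *ᵥ y = M *ᵥ w :=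
    (Matrix.mulVec_surjective_iff_isUnit.2 ((Matrix.isUnit_iff_isUnit_det A).2 (isUnit_iff_ne_zero.2 hdetA0))) _
  have hAy : A *ᵥ y = y 0 • v + y 1 • w + y 2 • v' := by
    funext k
    simp only [mulVec, dotProduct, Fin.sum_univ_three, hA0, hA1, hA2, Pi.add_apply, Pi.smul_apply, smul_eq_mul]
    ring
  have hc₁v : c₁ ⬝ᵥ v = 0 := by rw [← hc₁]; exact hiso_v
  have hc₁w : c₁ ⬝ᵥ w = 0 := by rw [← hc₁]; exact hvw
  have hc₁v' : c₁ ⬝ᵥ v' = a := by rw [← hc₁]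
  have hrv' : r ⬝ᵥ v' = 0 := by rw [← hF1]; exact hiso_v'
  have hrw : r ⬝ᵥ w = 0 := by rw [← hF1]; exact hv'w
  have hy2 : y 2 = 0 := by
    have e := hvMw
    rw [← hy, hAy, dotProduct_add, dotProduct_add, dotProduct_smul, dotProduct_smul, dotProduct_smul, hc₁v, hc₁w, hc₁v',
      smul_zero, smul_zero, zero_add, zero_add, smul_eq_mul] at e
    exact (mul_eq_zero.1 e).resolve_right ha0
  have hy0 : y 0 = 0 := by
    have e := hv'Mw
    rw [← hy, hAy, dotProduct_add, dotProduct_add, dotProduct_smul, dotProduct_smul, dotProduct_smul, ← hab, hrw, hrv',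
      smul_zero, smul_zero, add_zero, add_zero, smul_eq_mul] at e
    exact (mul_eq_zero.1 e).resolve_right hab0
  set β : K := y 1 with hβdef
  have hMw : M *ᵥ w = β • w := by rw [← hy, hAy, hy0, hy2, zero_smul, zero_smul, zero_add, add_zero]
  have hw0 : w ≠ 0 := by
    intro h
    apply hdetA0
    exact det_eq_zero_of_column_eq_zero 1 fun k => by rw [hA1, h, Pi.zero_apply]
  have hβ0 : β ≠ 0 := by
    intro h
    rw [h, zero_smul] at hMw
    exact hw0 ((Matrix.mulVec_injective_iff_isUnit.2 ((Matrix.isUnit_iff_isUnit_det M).2 (isUnit_iff_ne_zero.2 hdet)))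
      (by rw [hMw, mulVec_zero]))
  -- the normalised frame `B = [v | a⁻¹ w | a⁻¹ v']`
  set B : Matrix (Fin 3) (Fin 3) K := (Matrix.of ![v, a⁻¹ • w, a⁻¹ • v'])ᵀ with hBdef
  have hB0 : ∀ k, B k 0 = v k := fun k => by simp [hBdef]
  have hB1 : ∀ k, B k 1 = a⁻¹ * w k := fun k => by simp [hBdef]
  have hB2 : ∀ k, B k 2 = a⁻¹ * v' k := fun k => by simp [hBdef]
  have hBA : B = A * diagonal ![1, a⁻¹, a⁻¹] := by
    ext k j
    rw [mul_diagonal]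
    fin_cases j <;> simp [hA0, hA1, hA2, hB0, hB1, hB2, mul_comm]
  have hdetB : B.det ≠ 0 := by
    rw [hBA, det_mul, det_diagonal, Fin.prod_univ_three]
    simp only [cons_val_zero, cons_val_one, cons_val_two, Fin.isValue]
    exact mul_ne_zero hdetA0 (by simp [ha0])
  have hσainv : σ a⁻¹ = ab⁻¹ := by rw [map_inv₀, hσa]
  have hBc0 : (fun k => B k 0) = v := funext hB0
  have hBc1 : (fun k => B k 1) = a⁻¹ • w := funext fun k => by rw [hB1, Pi.smul_apply, smul_eq_mul]
  have hBc2 : (fun k => B k 2) = a⁻¹ • v' := funext fun k => by rw [hB2, Pi.smul_apply, smul_eq_mul]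
  have hJij : ∀ i' j', J i' j' = (!![0, 0, 1; 0, 1, 0; 1, 0, 0] : Matrix (Fin 3) (Fin 3) K) i' j' := fun i' j' => by rw [hJe]
  have G00 : hermForm σ J v v = 0 := hiso_v
  have G01 : hermForm σ J v (a⁻¹ • w) = 0 := by rw [hsr, hvw, mul_zero]
  have G02 : hermForm σ J v (a⁻¹ • v') = 1 := by rw [hsr, ← hadef, inv_mul_cancel₀ ha0]
  have G10 : hermForm σ J (a⁻¹ • w) v = 0 := by rw [hsl, hwv, mul_zero]
  have G11 : hermForm σ J (a⁻¹ • w) (a⁻¹ • w) = 1 := by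
    rw [hermForm_smul_smul_eq, ← hcdef, hc, hσainv]; field_simp
  have G12 : hermForm σ J (a⁻¹ • w) (a⁻¹ • v') = 0 := by rw [hermForm_smul_smul_eq, hwv', mul_zero]
  have G20 : hermForm σ J (a⁻¹ • v') v = 1 := by rw [hsl, ← habdef, hσainv, inv_mul_cancel₀ hab0]
  have G21 : hermForm σ J (a⁻¹ • v') (a⁻¹ • w) = 0 := by rw [hermForm_smul_smul_eq, hv'w, mul_zero]
  have G22 : hermForm σ J (a⁻¹ • v') (a⁻¹ • v') = 0 := by rw [hermForm_smul_smul_eq, hiso_v', mul_zero]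
  have hGramB : (B.map σ)ᵀ * J * B = J := by
    ext i' j'
    rw [transpose_map_mul_mul_apply, hJij]
    fin_cases i' <;> fin_cases j' <;> simp [hBc0, hBc1, hBc2, G00, G01, G02, G10, G11, G12, G20, G21, G22]
  -- the diagonal form
  set d : Fin 3 → K := ![α, β, αs] with hddef
  have hd : ∀ k, d k ≠ 0 := by
    intro k; fin_cases k
    · exact hα0
    · exact hβ0
    · exact hαs0
  have hMB : M * B = B * diagonal d := by
    ext k j
    have e0 := congrFun hv k
    have e1 := congrFun hMw k
    have e2 := congrFun hF2 k
    simp only [mulVec, dotProduct, Fin.sum_univ_three, Pi.smul_apply, smul_eq_mul] at e0 e1 e2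
    rw [mul_diagonal, mul_apply, Fin.sum_univ_three]
    fin_cases j
    · simp [hB0, hddef]; linear_combination e0
    · simp [hB1, hddef]; linear_combination a⁻¹ * e1
    · simp [hB2, hddef]; linear_combination a⁻¹ * e2
  refine ⟨B, hdetB, hGramB, d, hd, rfl, rfl, ?_⟩
  rw [Matrix.mul_assoc, hMB, ← Matrix.mul_assoc, Matrix.nonsing_inv_mul _ (isUnit_iff_ne_zero.2 hdetB), Matrix.one_mul]

end Core

/-! ## §2 The group form in `↥U(σ, Φ₃)(K)`: conjugation into `torusU`, and the eigenvalue CRITERION (E1 + E2) -/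

section Group

variable {K : Type*} [Field K] (σ : K →+* K)

/-- **«ELL-CRIT★» (E2).**  In `U = U(σ, Φ₃)(K)` (`K` a field, `σ` involutive): a REGULAR `γ` whose characteristic polynomial has a root `α ∈ K` with `α σ(α) ≠ 1`
is conjugate INTO THE SPLIT TORUS by an element of `U`: `∃ g ∈ U, g γ g⁻¹ = diag(d) ∈ M = torusU σ Φ₃`, with `d₀ = α`, `d₂ = σ(α)⁻¹` (and `d₁ σ(d₁) = 1` by the
torus relations).  Converse of ★ (E1) `exists_isRoot_of_conj_mem_torusU`; the (H3) step «isotropic eigenline ⇒ conjugate into `M`» of the hyperbolic-core road.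
[cite: Rogawski1990, §12.5 p. 182; §3.6; §1.10 p. 9] -/
theorem exists_conj_mem_torusU_of_isRoot (hσ : ∀ a, σ (σ a) = a) {J : Matrix (Fin 3) (Fin 3) K}
    (hJ : J = (StdForm.antidiagonal 3).over K) {γ : ↥(unitaryGroupOfForm σ J)} (hreg : IsRegularElt (γ : GL (Fin 3) K))
    {α : K} (hα : ((γ : GL (Fin 3) K) : Matrix (Fin 3) (Fin 3) K).charpoly.IsRoot α) (hne : α * σ α ≠ 1) :
    ∃ g : ↥(unitaryGroupOfForm σ J), g * γ * g⁻¹ ∈ torusU σ J ∧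
      ∃ d : Fin 3 → Kˣ, glDiagonal 3 K d = ((g * γ * g⁻¹ : ↥(unitaryGroupOfForm σ J)) : GL (Fin 3) K) ∧
        (d 0 : K) = α ∧ (d 2 : K) = (σ α)⁻¹ := by
  have hJ' : ∀ i j, J i j = if j = i.rev then 1 else 0 := fun i j => by rw [hJ, antidiagonal_over_apply]
  set M : Matrix (Fin 3) (Fin 3) K := ((γ : GL (Fin 3) K) : Matrix (Fin 3) (Fin 3) K) with hMdef
  have hM : (M.map σ)ᵀ * J * M = J := γ.2
  have hdet : M.det ≠ 0 := by
    rw [hMdef, ← Matrix.GeneralLinearGroup.val_det_apply]; exact Units.ne_zero _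
  obtain ⟨B, hB, hBU, d, hd, hd0, hd2, hdiag⟩ := exists_unitary_frame_diagonal_of_isRoot σ hσ hJ' hM hdet hreg hα hne
  set gB : GL (Fin 3) K := Matrix.GeneralLinearGroup.mkOfDetNeZero B hB with hgBdef
  have hgBval : (gB : Matrix (Fin 3) (Fin 3) K) = B := rfl
  have hgBU : gB ∈ unitaryGroupOfForm σ J := by rw [mem_unitaryGroupOfForm_iff, hgBval]; exact hBU
  set g : ↥(unitaryGroupOfForm σ J) := (⟨gB, hgBU⟩ : ↥(unitaryGroupOfForm σ J))⁻¹ with hgdef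
  have hconj : (((g * γ * g⁻¹ : ↥(unitaryGroupOfForm σ J)) : GL (Fin 3) K) : Matrix (Fin 3) (Fin 3) K) = B⁻¹ * M * B := by
    simp only [hgdef, inv_inv, Subgroup.coe_mul, InvMemClass.coe_inv, Units.val_mul, Matrix.coe_units_inv, hgBval, hMdef]
  set d' : Fin 3 → Kˣ := fun k => Units.mk0 (d k) (hd k) with hd'def
  have hgl : glDiagonal 3 K d' = ((g * γ * g⁻¹ : ↥(unitaryGroupOfForm σ J)) : GL (Fin 3) K) := by
    refine Units.ext ?_
    rw [coe_glDiagonal, hconj, hdiag]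
    congr 1
  exact ⟨g, (mem_torusU_iff _).2 ⟨d', hgl⟩, d', hgl, hd0, hd2⟩

/-- **THE EIGENVALUE CRITERION (E1 + E2).**  For a REGULAR `γ ∈ U(σ, Φ₃)(K)` (`K` a field, `σ` involutive): `γ` is `U`-conjugate into the split torus `M`
iff its characteristic polynomial has a root `α ∈ K` with `α σ(α) ≠ 1` — i.e. `γ ∉ ⋃_g g M g⁻¹` («elliptic» in the sense of the §12.5 datum's `ellG`) iff every
rational eigenvalue `α` has `α σ(α) = 1`. [cite: Rogawski1990, §12.5 p. 182; §3.6] -/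
theorem exists_conj_mem_torusU_iff (hσ : ∀ a, σ (σ a) = a) {J : Matrix (Fin 3) (Fin 3) K}
    (hJ : J = (StdForm.antidiagonal 3).over K) {γ : ↥(unitaryGroupOfForm σ J)} (hreg : IsRegularElt (γ : GL (Fin 3) K)) :
    (∃ g : ↥(unitaryGroupOfForm σ J), g * γ * g⁻¹ ∈ torusU σ J) ↔
      ∃ α : K, ((γ : GL (Fin 3) K) : Matrix (Fin 3) (Fin 3) K).charpoly.IsRoot α ∧ α * σ α ≠ 1 := by
  constructor
  · exact exists_isRoot_of_exists_conj_mem_torusU σ hJ hreg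
  · rintro ⟨α, hα, hne⟩
    obtain ⟨g, hg, -⟩ := exists_conj_mem_torusU_of_isRoot σ hσ hJ hreg hα hne
    exact ⟨g, hg⟩

end Group

/-! ## §3 The field-like carrier (`x ≠ 0 → IsUnit x`) -/

section FieldLike

variable {R : Type*} [CommRing R] [Nontrivial R] (σ : R →+* R)

/-- **(E2) OVER A FIELD-LIKE COMMUTATIVE RING** (every non-zero element a unit — the WEYL-HYP convention for the tree's local carrier `UnitaryGroup.LocalRing L v` at a
NON-SPLIT place `v`, a field only propositionally): same conclusion, the last slot recorded as `σ(α) · d₂ = 1`.  Proof: `IsField.toField` puts a `Field` structure on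
the SAME carrier whose `CommRing` reduct is the given one, and the field theorem applies on the nose. [cite: Rogawski1990, §12.5 p. 182; §3.6] -/
theorem exists_conj_mem_torusU_of_isRoot_of_isUnit (hR : ∀ x : R, x ≠ 0 → IsUnit x) (hσ : ∀ a, σ (σ a) = a)
    {J : Matrix (Fin 3) (Fin 3) R} (hJ : J = (StdForm.antidiagonal 3).over R) {γ : ↥(unitaryGroupOfForm σ J)}
    (hreg : IsRegularElt (γ : GL (Fin 3) R)) {α : R} (hα : ((γ : GL (Fin 3) R) : Matrix (Fin 3) (Fin 3) R).charpoly.IsRoot α)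
    (hne : α * σ α ≠ 1) :
    ∃ g : ↥(unitaryGroupOfForm σ J), g * γ * g⁻¹ ∈ torusU σ J ∧
      ∃ d : Fin 3 → Rˣ, glDiagonal 3 R d = ((g * γ * g⁻¹ : ↥(unitaryGroupOfForm σ J)) : GL (Fin 3) R) ∧
        (d 0 : R) = α ∧ σ α * (d 2 : R) = 1 := by
  have hF : IsField R := ⟨exists_pair_ne R, mul_comm, fun {a} ha => (hR a ha).exists_right_inv⟩
  letI : Field R := hF.toField
  obtain ⟨g, hg, d, hd, hd0, hd2⟩ := exists_conj_mem_torusU_of_isRoot σ hσ hJ hreg hα hne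
  have hσα : σ α ≠ 0 := by
    intro h
    rw [h, _root_.inv_zero] at hd2
    exact (d 2).ne_zero hd2
  exact ⟨g, hg, d, hd, hd0, by rw [hd2, mul_inv_cancel₀ hσα]⟩

end FieldLike

end Summit.HodgeConjecture.HodgeConjecture.Cruxes.H413.F0P3cStCharTSEllipticCriterionConverse
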